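import Summits.AnomalousDissipation.AnomalousDissipation.Theses.SawtoothPulseCascade
import Literature.Analysis.FluidPDE.SawtoothClosureMargin

/-!
# `SawtoothPulseCascade.ClosureMargin58` (stmt-AnomalousDissipation-19496): the localised closure
window on the strain box `γ ∈ [5, 8]`

Route `AnomalousDissipation/SawtoothPulseCascade`, support item `ClosureMargin58` (stub S0
`stub_closureMargin58` of the registered K3loc line `Cruxes.K3LocalisedClosure.Loc58`): for every
`γ ∈ [5, 8]`,
`3 · e^{σ⋆ γ} · ((γ² + 2) + √((γ² + 2)² − 4)) / 2 < (γ² − 3)²`,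
where `σ⋆ = sawSigmaStar = 0.30982` is the certified maximal Kelvin–Helmholtz rate per unit strain and
`((γ² + 2) + √((γ² + 2)² − 4)) / 2` is the largest singular value of the pulse-pair Jacobian.

The item is, verbatim, the landed Literature theorem
`Literature.Analysis.FluidPDE.SawtoothCascade.closureMargin58`
(`Literature/Analysis/FluidPDE/SawtoothClosureMargin.lean`; proof there: `‖B(γ)‖ < γ² + 2`, a chord bound
for `e^{σ⋆γ}` on `[5, 8]` from convexity with `Real.exp_bound'` end values, and a quartic with positive
Taylor coefficients at `γ = 5`; quantitative form `≤ (4/5)(γ² − 3)²` is `closureMargin58_le`), so the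
closing theorem is a one-line citation.
-/

-- `Summit.<Summit>.<Problem>` is the tree's mandated summit-side namespace (CONVENTIONS §2); for this
-- single-conjunct summit the two coincide, so the duplicate is deliberate (lakefile: off for `Summits`).
set_option linter.dupNamespace false

namespace Summit.AnomalousDissipation.AnomalousDissipation.Theorems

/-- Closes the route support item `ClosureMargin58` (stmt-AnomalousDissipation-19496): for every
`γ ∈ [5, 8]`, `3 · e^{σ⋆ γ} · ((γ² + 2) + √((γ² + 2)² − 4)) / 2 < (γ² − 3)²` — by the Literature
certificate `Literature.Analysis.FluidPDE.SawtoothCascade.closureMargin58`. -/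
theorem closureMargin58_proof :
    Summit.AnomalousDissipation.AnomalousDissipation.Theses.SawtoothPulseCascade.ClosureMargin58 := by
  unfold Summit.AnomalousDissipation.AnomalousDissipation.Theses.SawtoothPulseCascade.ClosureMargin58
  exact Literature.Analysis.FluidPDE.SawtoothCascade.closureMargin58

end Summit.AnomalousDissipation.AnomalousDissipation.Theorems
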